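import Summits.AtomisticToContinuum.BoseEinsteinCondensation.Theorems.BECThomsonPrincipleGDTransferSeededRoughNull
import Summits.AtomisticToContinuum.BoseEinsteinCondensation.Theorems.BECThomsonPrincipleGDTransferSeededIvtGlue
import Summits.AtomisticToContinuum.BoseEinsteinCondensation.Theorems.BECThomsonPrincipleGDTransferSeededCountLaw
import Summits.AtomisticToContinuum.BoseEinsteinCondensation.Theorems.BECThomsonPrincipleGDTransferSeededFreeCorner
import Literature.Barriers.AtomisticToContinuum.KineticGapLengthScales

/-!
# Route `BECThomsonPrinciple`, crux `GDTransfer` (stmt-AtomisticToContinuum-9482), line `seeded-continuity`: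
# fourth Defs file — the measurable TRANSPORT re-cut of the rough stub (lead c3, skeleton v6)

`Defs` file (D-0016) continuing `BECThomsonPrincipleGDTransferSeededDefs.lean` (p137609),
`…SeededWitnessDefs.lean` (p139431) and `…SeededRoughDefs.lean` (p147682).  Skeleton v5 left two registered stubs:
the SEED `stub_noBalancedCat` and `stub_essentiallyRough` (admissible profiles NOT a.e. equal to a finite continuous
one).  Skeleton v6 adopts the strategist's alternative re-cut `measurable-transport` (STRATEGY-CENSUS s1 §D.5,
`Cruxes/GDTransfer/Lines/measurable_transport.lean`) at that stub: the soft class on which the connectedness assembly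
(`stub_ivtGlue`, landed) runs is widened from FINITE CONTINUOUS profiles to ALL BOUNDED MEASURABLE admissible profiles
(soft spheres / square wells `B·𝟙[r ≤ R]`, every essentially discontinuous bounded profile), essentially bounded ones
being reduced to bounded ones by truncation at the essential bound plus the landed null-modification invariance
`stub_roughNull` (p148481).  The only place where the live chain uses continuity of the profile is the TRANSPORT of a
near-minimiser from side `L'` to side `L₁` (`stub_localConstancy`, p138765: uniform closeness
`sup |b⁻²u(·/b) − u| → 0`, `vb_scaledPotential_close`, false for a step profile).  It is replaced by a device needing
no regularity of the profile:

* `PairPotentialBound` (D): uniformly bounded, uniformly supported radial profiles whose lift `x ↦ w ‖x‖` has small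
  `L¹(ℝ³)` norm have small interaction energy on EVERY periodic state of bounded kinetic energy (fibrewise Hölder
  `L^{3/2} · L³` in one particle coordinate at frozen others, the periodic Sobolev inequality `H¹(cell) ⊂ L⁶(cell)` by
  the cut-off Gagliardo–Nirenberg–Sobolev template of `GenPoincare.poincare_sobolev_torus`, finitely many lattice
  images, `‖w‖_{3/2} ≤ B^{1/3}‖w‖₁^{2/3}`);
* `DilationL1` (E): `‖b⁻²u(·/b) − u‖_{L¹(ℝ³)} → 0` as `b → 1` for a bounded finite-range measurable profile, packaged
  as a two-sided pointwise sandwich `u_b ≤ u + w_b`, `u ≤ u_b + w_b` with `w_b` bounded, supported, `L¹`-small;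
* `ScaledCloseBdd`: (D)+(E) ⇒ the energies of `u` and of `b⁻²u(·/b)` are `ε`-close both ways on every state of kinetic
  energy `≤ K` at side `L₁`, for `b` close to `1`;
* `stub_localConstancyBdd`: `ScaledCloseBdd → CountLaw → LocalConstancy v` for bounded measurable admissible `v` (c1's
  proof of `stub_localConstancy` verbatim on top, with the a-priori kinetic bound `T(Φ) ≤ E(Φ) ≤ E₀ + 1` for
  near-minimisers; law stability at fixed `(N, L₁)`, `hiMass_toReal_close_of_nearMinimisers`, is already proved for
  measurable bounded finite-range profiles);
* `stub_bandEmptinessBdd`: the landed plain-pair dichotomy `gd_bandEmptiness` (p145164) re-run with `IsFiniteContinuous`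
  weakened to bounded measurability (continuity is consumed there only as integrability / Fubini bookkeeping —
  `continuous_pairWeight`, `lintegral_ne_top_of_isFiniteContinuous`);
* `stub_singularRest` [crux-sized, open]: the ESSENTIALLY UNBOUNDED regime — hard cores on a set of positive measure,
  essentially unbounded integrable profiles — given GD, the seed and periodic BEC for every bounded measurable
  admissible profile; implied by the crux (`singularRest_of_gdTransfer`).

Objects: `IsBoundedProfile`, `IsEssBoundedProfile`; statements `PairPotentialBound`, `DilationL1`, `ScaledCloseBdd`;
registered signatures `Sig.stub_bandEmptinessBdd`, `Sig.stub_pairPotentialBound`, `Sig.stub_dilationL1`,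
`Sig.stub_scaledCloseBdd`, `Sig.stub_localConstancyBdd`, `Sig.stub_singularRest`; glue `GDTransfer_of_transport`
(sorry-free over the landed `stub_countLaw` p138222, `stub_freeCorner` p138122, `stub_ivtGlue` p138348, `stub_roughNull`
p148481); sanity `singularRest_of_gdTransfer`, `isBoundedProfile_of_isFiniteContinuous`, `softSphere_mem`,
`essentiallyRough_of_transport`.  Nothing open is asserted: every `def … : Prop` is a statement consumed only as the
type of a stub theorem or as an explicit hypothesis.

References: LSSY2005 §1.2 (1.16), Ch. 2 (2.1) (admissible class: measurable, finite range), Ch. 5 footnote to (5.3)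
(scaling of the torus problem); Fournais2020 (1.1) (the periodic energy form); LiebLoss2001 Thm 8.3 (Sobolev).
-/

noncomputable section

open MeasureTheory Filter
open scoped ENNReal NNReal

namespace Summit.AtomisticToContinuum.BoseEinsteinCondensation.Cruxes.GDTransfer.Seeded

open Literature.MathematicalPhysics.QuantumManyBody.BoseGas
open Literature.Barriers.AtomisticToContinuum.BoseGas (scaledPotential)
open Summit.AtomisticToContinuum.BoseEinsteinCondensation.Theses.BECThomsonPrinciple
open Summit.AtomisticToContinuum.BoseEinsteinCondensation.Cruxes.GDTransfer.DysonDressedWitness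
  (PeriodicBECFor gdTransfer_iff)

/-! ## §0 Vocabulary -/

/-- Pointwise BOUNDED profile (no continuity): `v r ≤ B` for every radius `r ≥ 0` (negative arguments of a radial
profile are never evaluated: only `v ‖x‖` enters the energy; the symmetrised profile `r ↦ v |r|` is then bounded on
all of `ℝ`).  With `IsRepulsiveFiniteRange` (measurable, finite range) this is the class on which near-minimiser law
stability at fixed `(N, L)` is proved in tree (`hiMass_toReal_close_of_nearMinimisers`). -/
def IsBoundedProfile (v : ℝ → ℝ≥0∞) : Prop :=
  ∃ B : ℝ, ∀ r, 0 ≤ r → v r ≤ ENNReal.ofReal B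

/-- ESSENTIALLY bounded profile: the radial lift `x ↦ v ‖x‖` is bounded Lebesgue-a.e. on `ℝ³` (hard-core values on a
null set of radii are allowed; hard cores on positive measure and essentially unbounded profiles are not). -/
def IsEssBoundedProfile (v : ℝ → ℝ≥0∞) : Prop :=
  ∃ B : ℝ, ∀ᵐ x : Space, v ‖x‖ ≤ ENNReal.ofReal B

/-! ## §1 The statements of the transport device -/

/-- (D) **Pair-potential bound on kinetic-bounded states.**  At fixed particle number `N = m + 1`, side `L > 0`,
support radius `R`, height `B`, kinetic budget `K < ∞` and `ε > 0` there is `η > 0` such that every measurable radial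
profile `w ≤ B` vanishing beyond `R` whose lift has `∫_{ℝ³} w(|x|) dx ≤ η` has interaction energy `≤ ε` on every
periodic trial state of kinetic energy `≤ K`:
`∫_{cell^N} (Σ_{i<j} w^per(xᵢ − xⱼ)) |Φ|² ≤ ε`.  (Fibrewise Hölder + periodic Sobolev `H¹ ⊂ L⁶` on the 3-torus;
`‖w^per‖_{L^{3/2}(cell)} ≤ (C_img B)^{1/3} η^{2/3}`.) -/
def PairPotentialBound : Prop :=
  ∀ (m : ℕ) (L : ℝ), 0 < L → ∀ (R B : ℝ) (K : ℝ≥0∞), K ≠ ⊤ → ∀ ε : ℝ, 0 < ε →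
    ∃ η : ℝ, 0 < η ∧ ∀ w : ℝ → ℝ≥0∞, Measurable w → (∀ r, w r ≤ ENNReal.ofReal B) →
      (∀ r, R < r → w r = 0) → (∫⁻ x : Space, w ‖x‖) ≤ ENNReal.ofReal η →
      ∀ Φ : PeriodicTrialState (m + 1) L,
        (∫⁻ X in cellN (m + 1) L, kineticDensity Φ.ψ X) ≤ K →
        (∫⁻ X in cellN (m + 1) L, periodicInteraction w L X * (‖Φ.ψ X‖₊ : ℝ≥0∞) ^ 2) ≤
          ENNReal.ofReal ε

/-- (E) **`L¹`-continuity of dilations, as a two-sided sandwich.**  For a measurable profile `u ≤ B` of range `R₀` and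
`η > 0` there is `ϑ > 0` such that for `|b − 1| < ϑ` some measurable `w ≤ 4·max B 0` vanishing beyond `2·max R₀ 0` with
`∫_{ℝ³} w(|x|) dx ≤ η` sandwiches the scaled profile: `b⁻²u(|x|/b) ≤ u(|x|) + w(|x|)` and `u(|x|) ≤ b⁻²u(|x|/b) + w(|x|)`
(`w = |b⁻²u(·/b) − u|`; continuity of dilations in `L¹(ℝ³)` via a continuous compactly supported approximant). -/
def DilationL1 : Prop :=
  ∀ u : ℝ → ℝ≥0∞, Measurable u → ∀ B : ℝ, (∀ r, u r ≤ ENNReal.ofReal B) →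
    ∀ R₀ : ℝ, (∀ r, R₀ < r → u r = 0) → ∀ η : ℝ, 0 < η →
    ∃ ϑ : ℝ, 0 < ϑ ∧ ∀ b : ℝ, |b - 1| < ϑ →
      ∃ w : ℝ → ℝ≥0∞, Measurable w ∧ (∀ r, w r ≤ ENNReal.ofReal (4 * max B 0)) ∧
        (∀ r, 2 * max R₀ 0 < r → w r = 0) ∧ (∫⁻ x : Space, w ‖x‖) ≤ ENNReal.ofReal η ∧
        (∀ x : Space, scaledPotential u b ‖x‖ ≤ u ‖x‖ + w ‖x‖) ∧
        (∀ x : Space, u ‖x‖ ≤ scaledPotential u b ‖x‖ + w ‖x‖)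

/-- **Energies of `u` and of its scaled profile are close on kinetic-bounded states** (the output of (D)+(E)): for a
measurable profile `u ≤ B` of range `R₀`, at fixed `N = m + 1`, side `L > 0`, kinetic budget `K < ∞` and `ε > 0` there
is `ϑ > 0` such that for `|b − 1| < ϑ` every periodic trial state `Φ` at side `L` with kinetic energy `≤ K` has
`E_u(Φ) ≤ E_{b⁻²u(·/b)}(Φ) + ε` and `E_{b⁻²u(·/b)}(Φ) ≤ E_u(Φ) + ε`. -/
def ScaledCloseBdd : Prop :=
  ∀ u : ℝ → ℝ≥0∞, Measurable u → ∀ B : ℝ, (∀ r, u r ≤ ENNReal.ofReal B) →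
    ∀ R₀ : ℝ, (∀ r, R₀ < r → u r = 0) →
    ∀ (m : ℕ) (L : ℝ), 0 < L → ∀ K : ℝ≥0∞, K ≠ ⊤ → ∀ ε : ℝ, 0 < ε →
    ∃ ϑ : ℝ, 0 < ϑ ∧ ∀ b : ℝ, |b - 1| < ϑ → ∀ Φ : PeriodicTrialState (m + 1) L,
      (∫⁻ X in cellN (m + 1) L, kineticDensity Φ.ψ X) ≤ K →
      periodicEnergy u Φ ≤ periodicEnergy (scaledPotential u b) Φ + ENNReal.ofReal ε ∧
        periodicEnergy (scaledPotential u b) Φ ≤ periodicEnergy u Φ + ENNReal.ofReal ε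

/-! ## §2 Registered stub signatures (skeleton v6) -/

/-- Registered signature of `stub_bandEmptinessBdd` [M–L; the landed plain-pair dichotomy `gd_bandEmptiness`
(p145164 over p141210 p143854 p142740 p139731 p140462) re-run with `IsFiniteContinuous` replaced by bounded
measurability — continuity enters those files only as integrability/Fubini bookkeeping on the compact cell]. -/
def Sig.stub_bandEmptinessBdd : Prop :=
  GaussianDominationCan → ∀ v : ℝ → ℝ≥0∞, IsRepulsiveFiniteRange v → IsBoundedProfile v → BandEmptiness v

/-- Registered signature of `stub_pairPotentialBound` [L; the analytic heart of the device: fibrewise Hölder +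
periodic Sobolev on the 3-torus (template `GenPoincare.poincare_sobolev_torus`, Mathlib
`MeasureTheory.eLpNorm_le_eLpNorm_fderiv_of_eq_inner` with `p = 2, p* = 6, n = 3`)]. -/
def Sig.stub_pairPotentialBound : Prop :=
  PairPotentialBound

/-- Registered signature of `stub_dilationL1` [M; continuity of dilations in `L¹(ℝ³)` for a bounded compactly
supported measurable radial lift: approximate by a continuous compactly supported function
(`MeasureTheory.Memℒp.exists_hasCompactSupport_eLpNorm_sub_le`), dilate, change variables]. -/
def Sig.stub_dilationL1 : Prop :=
  DilationL1

/-- Registered signature of `stub_scaledCloseBdd` [S–M; (D)+(E) ⇒ closeness of the two energy functionals: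
`u_b ≤ u + w` periodises termwise (`vb_periodizedPotential_le_of_pointwise`) and sums over pairs, so
`E_{u_b}(Φ) ≤ E_u(Φ) + ∫ W_w |Φ|² ≤ E_u(Φ) + ε`]. -/
def Sig.stub_scaledCloseBdd : Prop :=
  PairPotentialBound → DilationL1 → ScaledCloseBdd

/-- Registered signature of `stub_localConstancyBdd` [M; c1's `stub_localConstancy` (p138765) with
`vb_scaledPotential_close` replaced by `ScaledCloseBdd` on near-minimisers (a-priori `T(Φ) ≤ E(Φ) ≤ E₀ + 1`), law
stability at fixed `(N, L₁)` by `hiMass_toReal_close_of_nearMinimisers` (measurable bounded finite-range, in tree)]. -/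
def Sig.stub_localConstancyBdd : Prop :=
  ScaledCloseBdd → CountLaw → ∀ v : ℝ → ℝ≥0∞, IsRepulsiveFiniteRange v → IsBoundedProfile v → LocalConstancy v

/-- Registered signature of `stub_singularRest` [crux-sized; the ESSENTIALLY UNBOUNDED regime — hard cores on a set of
positive measure (plain witnesses have `⊤` energy; GD's chord is silent there, `gdChord_of_energy_top`) and essentially
unbounded integrable profiles — given GD, the seed and periodic BEC for every bounded measurable admissible profile;
Dyson-dressed projected witnesses / inherited GD for `v ∧ n` at fixed `(N,L)` / hard ⇐ soft comparison (route
BECHardSphereComparison) / the torus twin of `ScatteringLengthTransfer` (stmt-9048); implied by the crux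
(`singularRest_of_gdTransfer`)]. -/
def Sig.stub_singularRest : Prop :=
  GaussianDominationCan → NoBalancedCat →
    (∀ w : ℝ → ℝ≥0∞, IsRepulsiveFiniteRange w → IsBoundedProfile w → PeriodicBECFor w) →
    ∀ v : ℝ → ℝ≥0∞, IsRepulsiveFiniteRange v → ¬ IsEssBoundedProfile v → PeriodicBECFor v

/-! ## §3 Composition (sorry-free): the seven statements give the crux BY NAME -/

/-- Truncation of an admissible profile at height `B` is admissible and bounded. -/
theorem isRepulsiveFiniteRange_min {v : ℝ → ℝ≥0∞} (hv : IsRepulsiveFiniteRange v) (B : ℝ) :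
    IsRepulsiveFiniteRange (fun r => min (v r) (ENNReal.ofReal B)) ∧
      IsBoundedProfile (fun r => min (v r) (ENNReal.ofReal B)) := by
  refine ⟨⟨hv.1.min measurable_const, ?_⟩, B, fun r _ => min_le_right _ _⟩
  obtain ⟨R₀, hR₀⟩ := hv.2
  exact ⟨R₀, fun r hr => by simp [hR₀ r hr]⟩

/-- **The line (skeleton v6) concludes the crux BY NAME.**  Bounded measurable profiles through the connectedness
assembly (count law, seed, band emptiness from GD, free corner, local constancy by the measurable transport);
essentially bounded profiles by truncation at the essential bound + the landed null-modification invariance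
`stub_roughNull`; the essentially unbounded rest through `stub_singularRest` fed with that conclusion. -/
theorem GDTransfer_of_transport : Summit.AtomisticToContinuum.BoseEinsteinCondensation.Cruxes.GDTransfer.Seeded.Sig.stub_noBalancedCat → Summit.AtomisticToContinuum.BoseEinsteinCondensation.Cruxes.GDTransfer.Seeded.Sig.stub_bandEmptinessBdd → Summit.AtomisticToContinuum.BoseEinsteinCondensation.Cruxes.GDTransfer.Seeded.Sig.stub_pairPotentialBound → Summit.AtomisticToContinuum.BoseEinsteinCondensation.Cruxes.GDTransfer.Seeded.Sig.stub_dilationL1 → Summit.AtomisticToContinuum.BoseEinsteinCondensation.Cruxes.GDTransfer.Seeded.Sig.stub_scaledCloseBdd → Summit.AtomisticToContinuum.BoseEinsteinCondensation.Cruxes.GDTransfer.Seeded.Sig.stub_localConstancyBdd → Summit.AtomisticToContinuum.BoseEinsteinCondensation.Cruxes.GDTransfer.Seeded.Sig.stub_singularRest → Summit.AtomisticToContinuum.BoseEinsteinCondensation.Theses.BECThomsonPrinciple.GDTransfer := by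
  intro hSeed hBand hPair hDil hScaled hLoc hRest
  rw [gdTransfer_iff]
  intro hG v hv
  have hsoft : ∀ w : ℝ → ℝ≥0∞, IsRepulsiveFiniteRange w → IsBoundedProfile w → PeriodicBECFor w :=
    fun w hw hb => stub_ivtGlue stub_countLaw hSeed w hw (hBand hG w hw hb) (stub_freeCorner w hw)
      (hLoc (hScaled hPair hDil) stub_countLaw w hw hb)
  by_cases hess : IsEssBoundedProfile v
  · obtain ⟨B, hB⟩ := hess
    obtain ⟨hw, hwb⟩ := isRepulsiveFiniteRange_min hv B
    have hae : ∀ᵐ x : Space, v ‖x‖ = min (v ‖x‖) (ENNReal.ofReal B) :=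
      hB.mono fun x hx => (min_eq_left hx).symm
    exact stub_roughNull v _ hv hw hae (hsoft _ hw hwb)
  · exact hRest hG hSeed hsoft v hv hess

/-! ## §4 Sanity (sorry-free) -/

/-- The rest stub is a weakening of the crux (implied by it) — not a costume of it: it only meets essentially
unbounded profiles and is fed the bounded conclusion. -/
theorem singularRest_of_gdTransfer (h : GDTransfer) : Sig.stub_singularRest :=
  fun hG _ _ v hv _ => (gdTransfer_iff.mp h) hG v hv

/-- Finite continuous admissible profiles are bounded on `[0, ∞)` (so skeleton v6's soft class contains v5's):
the lift `x ↦ v ‖x‖` is continuous, finite and compactly supported on `ℝ³`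
(`exists_bound_of_continuous_finiteRange`). -/
theorem isBoundedProfile_of_isFiniteContinuous {v : ℝ → ℝ≥0∞} (hv : IsRepulsiveFiniteRange v)
    (hfc : IsFiniteContinuous v) : IsBoundedProfile v := by
  obtain ⟨hfin, hcont⟩ := hfc
  obtain ⟨R₀, hR₀⟩ := hv.2
  obtain ⟨M, hM⟩ :=
    Summit.AtomisticToContinuum.BoseEinsteinCondensation.Theorems.exists_bound_of_continuous_finiteRange
      hfin hcont hR₀
  refine ⟨M, fun r hr => ?_⟩
  have h := hM (EuclideanSpace.single 0 r)
  have hn : ‖EuclideanSpace.single (0 : Fin 3) r‖ = r := by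
    rw [EuclideanSpace.norm_eq]
    simp [Real.sqrt_sq_eq_abs, abs_of_nonneg hr]
  rw [hn] at h
  exact h.trans (by simp)

/-- The v5 rest stub `stub_essentiallyRough` follows from the v6 pair (soft conclusion on the bounded class + rest):
a profile that is not a null modification of a finite continuous one is either essentially bounded — then it is a
null modification of its own truncation, which is bounded measurable admissible — or essentially unbounded. So v6
REFINES v5 (nothing of v5 is lost). -/
theorem essentiallyRough_of_transport
    (hsoftB : GaussianDominationCan → NoBalancedCat →
      ∀ w : ℝ → ℝ≥0∞, IsRepulsiveFiniteRange w → IsBoundedProfile w → PeriodicBECFor w)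
    (hRest : Sig.stub_singularRest) : Sig.stub_essentiallyRough := by
  intro hG hSeed _ v hv _
  by_cases hess : IsEssBoundedProfile v
  · obtain ⟨B, hB⟩ := hess
    obtain ⟨hw, hwb⟩ := isRepulsiveFiniteRange_min hv B
    have hae : ∀ᵐ x : Space, v ‖x‖ = min (v ‖x‖) (ENNReal.ofReal B) :=
      hB.mono fun x hx => (min_eq_left hx).symm
    exact stub_roughNull v _ hv hw hae (hsoftB hG hSeed _ hw hwb)
  · exact hRest hG hSeed (hsoftB hG hSeed) v hv hess

/-- The soft-sphere / square-well profile `B·𝟙[r ≤ R]` (discontinuous, NOT in v5's finite-continuous class) is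
admissible and bounded, hence inside skeleton v6's soft class. -/
theorem softSphere_mem {B R : ℝ} :
    IsRepulsiveFiniteRange (fun r => if r ≤ R then ENNReal.ofReal B else 0) ∧
      IsBoundedProfile (fun r => if r ≤ R then ENNReal.ofReal B else 0) := by
  refine ⟨⟨?_, R, fun r hr => by simp [not_le.mpr hr]⟩, B, fun r _ => ?_⟩
  · exact Measurable.ite measurableSet_Iic measurable_const measurable_const
  · by_cases h : r ≤ R <;> simp [h]

end Summit.AtomisticToContinuum.BoseEinsteinCondensation.Cruxes.GDTransfer.Seeded

end
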